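import Literature.NumberTheory.QuadraticFields.QuadraticDedekindZetaKronecker
import Literature.NumberTheory.QuadraticFields.KroneckerCharacterFourProofs
import Literature.NumberTheory.QuadraticFields.FundamentalDiscriminant
import Literature.NumberTheory.LFunctions.DedekindZetaProofs
import Literature.NumberTheory.LFunctions.AutomorphicGRHProofs
import HarnessLib

/-!
# Hallgren 2005 / class numbers under GRH — step N2: the Grand Riemann Hypothesis gives ERH for
# quadratic fields (`ζ_K = ζ · L(·, χ_{d_K})` off `s = 1`)

Topic `Literature/Computability/Cryptography`; second proof companion of `HallgrenClassGroup.lean`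
(named fact `Hallgren2005_classNumber_qsolvable_of_GRH`). Everything here is PROVED (theorems
only; no definition, no named fact).

The hypothesis of the fact is the tree's `GrandRiemannHypothesisGL` (GRH for the standard
`L`-functions of all cuspidal automorphic representations of all `GL_n(𝔸_ℚ)`). The analytic input
the class-number algorithm needs is the Riemann hypothesis for the Dedekind zeta function of the
imaginary quadratic field `K = ℚ(√−d)` (`NumberField.ExtendedRiemannHypothesis K`, the hypothesis
of the tree's GRH-conditional prime ideal theorems `DedekindPsiGRHBound`,
`GRHChebyshevPsiLowerBound`, `GRHPrimeIdealCountLowerBound`). This file derives it: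

* `isDedekindZetaContinuation_zeta_mul_LFunction` — if `ζ_K(s) = ζ(s) L(s, κ)` on `Re s > 1`
  (Dirichlet series) then `s ↦ ζ(s) · L(s, κ)` (Mathlib's continued functions) is a continuation of
  `ζ_K` to `ℂ ∖ {1}`; hence `dedekindZetaCont K s = ζ(s) L(s, κ)` for `s ≠ 1`
  (`dedekindZetaCont_eq_zeta_mul_LFunction`, uniqueness of the continuation);
* `exists_dedekindZeta_eq_zeta_mul_LSeries` — for every quadratic field there is such a `κ` (odd
  `d_K`: the Jacobi character mod `|d_K|`, `Quadratic.dedekindZeta_eq_riemannZeta_mul_LSeries`;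
  even `d_K = 4m`: the character mod `4|m|` of `exists_dirichletCharacter_four_mul`, fed to
  `Quadratic.dedekindZeta_eq_riemannZeta_mul_LSeries_of_kronecker`);
* `extendedRiemannHypothesis_of_generalizedRiemannHypothesis` — **GRH for Dirichlet `L`-functions
  implies ERH for every quadratic field** (a zero of `ζ_K` in the open strip is a zero of `ζ` or
  of `L(s, κ)`);
* `extendedRiemannHypothesis_of_grandRiemannHypothesisGL` — the same from `GrandRiemannHypothesisGL`
  through the tree's proved `GL_1` bridge `automorphicGRH_one_iff_generalizedRiemannHypothesis_holds`.

(The cyclotomic analogue is the tree's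
`GeneralizedRiemannHypothesis.extendedRiemannHypothesis_of_isCyclotomicExtension`,
`RHGeneralizedRHProofs.lean`; the pattern of proof is the same.)

## References

* H. Davenport, *Multiplicative Number Theory*, Ch. 6 (`ζ_K = ζ L(χ_d)` for quadratic fields)
  [DavenportMNT1980].
* H. L. Montgomery, R. C. Vaughan, *Multiplicative Number Theory I* (2007), §10.1 Exercise 26
  [MontgomeryVaughan2007].
* A. M. Childs, W. van Dam, Rev. Mod. Phys. 82 (2010), §5.7 ("assuming the GRH") [ChildsVandam2010].
-/

noncomputable section

namespace Literature.Computability.Cryptography.Hallgren2005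

open Module NumberField Complex Set
open Literature.NumberTheory.LFunctions Literature.NumberTheory.QuadraticFields
open scoped NumberTheorySymbols

variable {K : Type*} [Field K] [NumberField K]

/-- **`ζ · L(·, κ)` continues `ζ_K`.** If `ζ_K(s) = ζ(s) L(s, κ)` as Dirichlet series on `Re s > 1`,
then `s ↦ ζ(s) L(s, κ)` (Mathlib's `riemannZeta` and `DirichletCharacter.LFunction`, holomorphic
off `s = 1`) is a continuation of `ζ_K` in the sense of `IsDedekindZetaContinuation`.
[cite: DavenportMNT1980, Ch. 6] -/
theorem isDedekindZetaContinuation_zeta_mul_LFunction {M : ℕ} [NeZero M]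
    (κ : DirichletCharacter ℂ M)
    (hζ : ∀ s : ℂ, 1 < s.re → dedekindZeta K s = riemannZeta s * LSeries (fun n => κ n) s) :
    IsDedekindZetaContinuation K (fun s => riemannZeta s * κ.LFunction s) where
  differentiableOn := fun s hs =>
    ((differentiableAt_riemannZeta hs).mul
      (DirichletCharacter.differentiableAt_LFunction κ s (Or.inl hs))).differentiableWithinAt
  eqOn := fun s hs => by
    simp only [Set.mem_setOf_eq] at hs
    show riemannZeta s * κ.LFunction s = dedekindZeta K s
    rw [DirichletCharacter.LFunction_eq_LSeries κ hs, hζ s hs]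

/-- Hence **`ζ_K(s) = ζ(s) L(s, κ)` for every `s ≠ 1`**, `ζ_K = dedekindZetaCont K` the continued
Dedekind zeta function (uniqueness of the continuation,
`IsDedekindZetaContinuation.eqOn_dedekindZetaCont_holds`). [cite: DavenportMNT1980, Ch. 6] -/
theorem dedekindZetaCont_eq_zeta_mul_LFunction {M : ℕ} [NeZero M] (κ : DirichletCharacter ℂ M)
    (hζ : ∀ s : ℂ, 1 < s.re → dedekindZeta K s = riemannZeta s * LSeries (fun n => κ n) s)
    {s : ℂ} (hs : s ≠ 1) : dedekindZetaCont K s = riemannZeta s * κ.LFunction s :=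
  (IsDedekindZetaContinuation.eqOn_dedekindZetaCont_holds
    (isDedekindZetaContinuation_zeta_mul_LFunction κ hζ) hs).symm

/-- **Every quadratic field has a Kronecker character**: for `[K : ℚ] = 2` there is a Dirichlet
character `κ` (to some modulus) with `ζ_K(s) = ζ(s) L(s, κ)` on `Re s > 1`. Odd `d_K`: `κ` is the
Jacobi character mod `|d_K|` (`Quadratic.dedekindZeta_eq_riemannZeta_mul_LSeries`). Even
`d_K = 4m`: `κ` is the character mod `4|m|` with `κ(n) = (m / n)` for odd `n`
(`exists_dirichletCharacter_four_mul`); it has the Kronecker values `κ(p) = (d_K / p) = (m / p)` at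
odd primes and `κ(2) = 0`, so `Quadratic.dedekindZeta_eq_riemannZeta_mul_LSeries_of_kronecker`
applies. [cite: MontgomeryVaughan2007, §10.1 Exercise 26] -/
theorem exists_dedekindZeta_eq_zeta_mul_LSeries (h2 : finrank ℚ K = 2) :
    ∃ (M : ℕ) (_ : NeZero M) (κ : DirichletCharacter ℂ M),
      ∀ s : ℂ, 1 < s.re → dedekindZeta K s = riemannZeta s * LSeries (fun n => κ n) s := by
  rcases Int.even_or_odd (NumberField.discr K) with hev | hodd
  · -- even discriminant `d_K = 4m`
    set D : ℤ := NumberField.discr K with hDdef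
    obtain ⟨hD1, -, -⟩ | ⟨h4, -, hsq⟩ := Quadratic.isFundamentalDiscriminant_discr (K := K) h2
    · exfalso
      obtain ⟨k, hk⟩ := hev
      omega
    have hm0 : D / 4 ≠ 0 := hsq.ne_zero
    have hDm : D = 4 * (D / 4) := (Int.mul_ediv_cancel' h4).symm
    haveI : NeZero (4 * (D / 4).natAbs) :=
      ⟨mul_ne_zero (by norm_num) (Int.natAbs_ne_zero.mpr hm0)⟩
    obtain ⟨κ, hκ⟩ := exists_dirichletCharacter_four_mul (D / 4) hm0
    refine ⟨4 * (D / 4).natAbs, inferInstance, κ, fun s hs =>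
      Quadratic.dedekindZeta_eq_riemannZeta_mul_LSeries_of_kronecker h2 κ ?_ ?_ hs⟩
    · intro p hp hp2
      have hpodd : Odd p := hp.odd_of_ne_two hp2
      have hgcd : Int.gcd (2 : ℤ) (p : ℤ) = 1 := by
        show Nat.gcd 2 p = 1
        exact Nat.coprime_two_left.mpr hpodd
      have h4 : J(4 * (D / 4) | p) = J(D / 4 | p) := by
        rw [jacobiSym.mul_left, show (4 : ℤ) = 2 ^ 2 by norm_num, jacobiSym.sq_one' hgcd, one_mul]
      rw [hκ p hpodd, ← hDdef, ← h4, ← hDm]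
    · have hval : Even ((2 : ZMod (4 * (D / 4).natAbs)).val) := by
        have h8 : (4 : ℕ) ≤ 4 * (D / 4).natAbs := by
          have := Int.natAbs_pos.mpr hm0
          omega
        rw [show (2 : ZMod (4 * (D / 4).natAbs)) = ((2 : ℕ) : ZMod (4 * (D / 4).natAbs)) by
          norm_cast, ZMod.val_natCast, Nat.mod_eq_of_lt (by omega)]
        exact even_two
      rw [apply_eq_zero_of_even (χ := κ) hval, ← hDdef]
      have h81 : ¬ D % 8 = 1 := by omega
      have h85 : ¬ D % 8 = 5 := by omega
      rw [if_neg h81, if_neg h85]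
  · -- odd discriminant
    exact ⟨(NumberField.discr K).natAbs, inferInstance, jacobiChar (NumberField.discr K).natAbs,
      fun s hs => Quadratic.dedekindZeta_eq_riemannZeta_mul_LSeries h2 hodd hs⟩

/-- **GRH for Dirichlet `L`-functions implies ERH for every quadratic field.** With
`ζ_K(s) = ζ(s) L(s, κ)` off `s = 1` (`dedekindZetaCont_eq_zeta_mul_LFunction`), a zero of the
continued `ζ_K` in the open critical strip is a zero of `ζ = L(·, 1)` or of `L(·, κ)`, hence on
`Re s = 1/2` under `GeneralizedRiemannHypothesis`. [cite: DavenportMNT1980, Ch. 6] -/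
theorem extendedRiemannHypothesis_of_generalizedRiemannHypothesis
    (hGRH : GeneralizedRiemannHypothesis) (h2 : finrank ℚ K = 2) :
    NumberField.ExtendedRiemannHypothesis K := by
  intro s hs h0 h1
  have hs1 : s ≠ 1 := fun h => by simp [h] at h1
  obtain ⟨M, _, κ, hκ⟩ := exists_dedekindZeta_eq_zeta_mul_LSeries h2
  rw [dedekindZetaCont_eq_zeta_mul_LFunction κ hκ hs1, mul_eq_zero] at hs
  rcases hs with hz | hL
  · refine hGRH 1 (1 : DirichletCharacter ℂ 1) s ?_ h0 h1
    rwa [DirichletCharacter.LFunction_modOne_eq]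
  · exact hGRH M κ s hL h0 h1

/-- **The Grand Riemann Hypothesis for `GL` implies ERH for every quadratic field**: through the
tree's proved `GL_1` bridge `automorphicGRH_one_iff_generalizedRiemannHypothesis_holds`
(`AutomorphicGRHProofs.lean`: the cuspidal automorphic `L`-functions of `GL_1(𝔸_ℚ)` are the
Dirichlet `L`-functions of primitive characters) and
`extendedRiemannHypothesis_of_generalizedRiemannHypothesis`. This is the form in which the
hypothesis of `Hallgren2005_classNumber_qsolvable_of_GRH` enters the class-number algorithm
("assuming the GRH", Childs–van Dam 2010, §5.7). [cite: ChildsVandam2010, §5.7 (p. 24 of arXiv:0812.0380)] -/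
theorem extendedRiemannHypothesis_of_grandRiemannHypothesisGL (hGL : GrandRiemannHypothesisGL)
    (h2 : finrank ℚ K = 2) : NumberField.ExtendedRiemannHypothesis K :=
  extendedRiemannHypothesis_of_generalizedRiemannHypothesis
    (hGL.generalizedRiemannHypothesis automorphicGRH_one_iff_generalizedRiemannHypothesis_holds) h2

end Literature.Computability.Cryptography.Hallgren2005

end
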